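import Literature.Analysis.Calculus.LiouvilleDeterminant
import Mathlib.LinearAlgebra.Matrix.Charpoly.Coeff
import Mathlib.Analysis.Calculus.Deriv.Polynomial
import Mathlib.Analysis.SpecialFunctions.Sqrt
import Mathlib.Analysis.SpecialFunctions.Log.Deriv
import HarnessLib

/-!
# Jacobi's formula in any dimension: `(det A)' = det A · tr (A⁻¹ A')`

Topic `Literature/Analysis/Calculus`. The tree's `LiouvilleDeterminant.lean` proves the row form of
Jacobi's formula for curves of frames in any dimension (`hasDerivAt_det_rows`, multilinearity of
`det` in the rows) but the TRACE form only on `ℝ³` (`sum_det_of_update_mulVec`, by `ring`). Here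
the trace form in every finite dimension:

* `hasDerivAt_det_one_add_smul` — `d/dr det (1 + r M)|₀ = tr M` (Mathlib's expansion
  `Matrix.det_one_add_smul`);
* `sum_det_updateRow_mulVec` — **the trace identity** `Σⱼ det (M.updateRow j (B Mⱼ)) = tr B · det M`
  (differentiate `r ↦ det (M (1 + r Bᵀ)) = det M det (1 + r Bᵀ)` in the two ways);
* `hasDerivAt_det_of_eq_mul`, `hasDerivAt_det_eq_det_mul_trace` —
  **Jacobi's formula** `(det A)' = det A(t) · tr (A(t)⁻¹ A'(t))` for invertible `A(t)` (the row
  form `(det A)'(t) = Σⱼ det (A(t) with row j replaced by A'(t)ⱼ)` is the tree's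
  `hasDerivAt_det_rows` in `LiouvilleDeterminant.lean`, used directly);
  `hasDerivAt_log_det` — `(log det A)' = tr (A⁻¹ A')`; `hasDerivAt_sqrt_det` —
  `(√det A)' = ½ √det A · tr (A⁻¹ A')`, the evolution of a Riemannian area element `√det g(t)` in a
  chart (for an evolving metric; e.g. `∂ₜ √det g = -H² √det g` along mean curvature flow, where
  `tr (g⁻¹ ∂ₜ g) = -2H²`).

Curves of matrices are typed `ℝ → ι → ι → ℝ` (read through `Matrix.of`) so that the `sup` norm
of `ι → ι → ℝ` is used for derivatives, as in `LiouvilleDeterminant.lean`. Everything is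
PROVED; no definitions, no named facts.

## References

* A. J. Majda, A. L. Bertozzi, *Vorticity and Incompressible Flow*, CUP 2002, §1.3, proof of
  Prop. 1.2 (Jacobi's formula by multilinearity). [MajdaBertozziCUP2002]
* R. A. Horn, C. R. Johnson, *Matrix Analysis*, 2nd ed. (2013), §0.8.10 (Jacobi's formula)
  (cited for the statement; standard).
-/

noncomputable section

open Function Set Matrix
open scoped Matrix

namespace Literature.Analysis.Calculus

variable {ι : Type*} [Fintype ι] [DecidableEq ι]

/-! ### The derivative of `det (1 + r M)` at `r = 0` is `tr M` -/

/-- **`d/dr det(1 + r M)|_{r=0} = tr M`** (from Mathlib's expansion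
`det (1 + r M) = 1 + tr M · r + q(r) r²`, `Matrix.det_one_add_smul`). [folklore] -/
theorem hasDerivAt_det_one_add_smul (M : Matrix ι ι ℝ) :
    HasDerivAt (fun r : ℝ ↦ (1 + r • M).det) M.trace 0 := by
  set P := (1 + (Polynomial.X : Polynomial ℝ) • M.map Polynomial.C).det.divX.divX with hP
  have hfun : (fun r : ℝ ↦ (1 + r • M).det) = fun r ↦ 1 + M.trace * r + Polynomial.eval r P * r ^ 2 := by
    funext r
    rw [Matrix.det_one_add_smul r M]
  rw [hfun]
  have h1 : HasDerivAt (fun r : ℝ ↦ 1 + M.trace * r) M.trace 0 := by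
    refine (((hasDerivAt_id (0 : ℝ)).const_mul M.trace).const_add 1).congr_deriv ?_
    simp
  have h2 : HasDerivAt (fun r : ℝ ↦ Polynomial.eval r P * r ^ 2) 0 0 := by
    refine ((P.hasDerivAt 0).mul (hasDerivAt_pow 2 (0 : ℝ))).congr_deriv ?_
    simp
  exact (h1.add h2).congr_deriv (add_zero _)

/-! ### The trace identity `Σⱼ det (M with row j replaced by B Mⱼ) = tr B · det M` -/

omit [DecidableEq ι] in
/-- The straight line of matrices `r ↦ M + r N` has derivative `N`. [folklore] -/
theorem hasDerivAt_add_smul_matrix (M N : ι → ι → ℝ) (r₀ : ℝ) :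
    HasDerivAt (fun r : ℝ ↦ M + r • N) N r₀ := by
  have h := ((hasDerivAt_id r₀).smul_const N).const_add M
  refine h.congr_deriv ?_
  simp

/-- **The trace identity in any dimension**: for matrices `M, B`,
`Σⱼ det (M.updateRow j (B *ᵥ M j)) = tr B · det M` — the derivative at `r = 0` of
`r ↦ det (M (1 + r Bᵀ)) = det M · det (1 + r Bᵀ)`, computed once by multilinearity in the rows
(`hasDerivAt_det_rows`, the rows of `M Bᵀ` being `B Mⱼ`) and once by
`hasDerivAt_det_one_add_smul`. (The tree's `sum_det_of_update_mulVec` is the case `ι = Fin 3`,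
by `ring`.) [folklore] -/
theorem sum_det_updateRow_mulVec (M B : Matrix ι ι ℝ) :
    ∑ j, (M.updateRow j (B *ᵥ M j)).det = B.trace * M.det := by
  -- the curve `r ↦ M (1 + r Bᵀ) = M + r (M Bᵀ)` and its determinant
  have hcurve : HasDerivAt (fun r : ℝ ↦ (M + r • (M * Bᵀ) : ι → ι → ℝ)) (M * Bᵀ : ι → ι → ℝ) 0 :=
    hasDerivAt_add_smul_matrix (M : ι → ι → ℝ) (M * Bᵀ : ι → ι → ℝ) 0
  have hrows : ∀ j, (M * Bᵀ) j = B *ᵥ M j := by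
    intro j
    funext i
    simp only [Matrix.mul_apply, Matrix.transpose_apply, Matrix.mulVec, dotProduct]
    exact Finset.sum_congr rfl fun l _ ↦ mul_comm _ _
  -- (1) by multilinearity in the rows
  have h1 := hasDerivAt_det_rows (ι := ι) (m := fun r : ℝ ↦ (M + r • (M * Bᵀ) : ι → ι → ℝ))
    (m' := (M * Bᵀ : ι → ι → ℝ)) (t := 0) hcurve
  simp only [zero_smul, add_zero] at h1
  -- (2) by `det (M N) = det M det N` and the derivative of `det (1 + r Bᵀ)`
  have hfun : (fun r : ℝ ↦ (Matrix.of (M + r • (M * Bᵀ) : ι → ι → ℝ)).det) =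
      fun r ↦ M.det * (1 + r • Bᵀ).det := by
    funext r
    have : (Matrix.of (M + r • (M * Bᵀ) : ι → ι → ℝ)) = M * (1 + r • Bᵀ) := by
      rw [Matrix.mul_add, Matrix.mul_one, Matrix.mul_smul]; rfl
    rw [this, Matrix.det_mul]
  have h2 : HasDerivAt (fun r : ℝ ↦ (Matrix.of (M + r • (M * Bᵀ) : ι → ι → ℝ)).det)
      (M.det * Bᵀ.trace) 0 := by
    rw [hfun]
    exact (hasDerivAt_det_one_add_smul Bᵀ).const_mul M.det
  have heq := h1.unique h2
  rw [Matrix.trace_transpose] at heq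
  -- identify the rows
  have hsum : ∑ j, (M.updateRow j (B *ᵥ M j)).det =
      ∑ j, (Matrix.of (update (M : ι → ι → ℝ) j ((M * Bᵀ) j))).det := by
    refine Finset.sum_congr rfl fun j _ ↦ ?_
    rw [hrows j]
    rfl
  rw [hsum, heq, mul_comm]

/-! ### Jacobi's formula for matrix curves -/

/-- **Jacobi's formula for a right factorisation `A' = A(t) C`**: `(det A)' = det A(t) · tr C`
(from the row form `hasDerivAt_det_rows`, read through `Matrix.updateRow M j b = of (update M j b)`,
and the trace identity `sum_det_updateRow_mulVec`). [folklore] -/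
theorem hasDerivAt_det_of_eq_mul {A : ℝ → ι → ι → ℝ} {C : Matrix ι ι ℝ} {t : ℝ}
    (hA : HasDerivAt A (Matrix.of (A t) * C : ι → ι → ℝ) t) :
    HasDerivAt (fun u ↦ (Matrix.of (A u)).det) ((Matrix.of (A t)).det * C.trace) t := by
  have h : HasDerivAt (fun u ↦ (Matrix.of (A u)).det)
      (∑ j, ((Matrix.of (A t)).updateRow j ((Matrix.of (A t) * C : ι → ι → ℝ) j)).det) t :=
    hasDerivAt_det_rows hA
  have hrows : ∀ j, (Matrix.of (A t) * C) j = Cᵀ *ᵥ (Matrix.of (A t)) j := by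
    intro j
    funext i
    simp only [Matrix.mul_apply, Matrix.transpose_apply, Matrix.mulVec, dotProduct]
    exact Finset.sum_congr rfl fun l _ ↦ mul_comm _ _
  have hsum : ∑ j, ((Matrix.of (A t)).updateRow j ((Matrix.of (A t) * C : ι → ι → ℝ) j)).det =
      (Matrix.of (A t)).det * C.trace := by
    have : ∀ j, (Matrix.of (A t) * C : ι → ι → ℝ) j = Cᵀ *ᵥ (Matrix.of (A t)) j := hrows
    simp_rw [this]
    rw [sum_det_updateRow_mulVec, Matrix.trace_transpose, mul_comm]
  rwa [hsum] at h

/-- **Jacobi's formula**: if `A(t)` is invertible then `(det A)'(t) = det A(t) · tr (A(t)⁻¹ A'(t))`.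
[folklore] -/
theorem hasDerivAt_det_eq_det_mul_trace {A : ℝ → ι → ι → ℝ} {A' : Matrix ι ι ℝ} {t : ℝ}
    (hA : HasDerivAt A (A' : ι → ι → ℝ) t) (hinv : IsUnit (Matrix.of (A t)).det) :
    HasDerivAt (fun u ↦ (Matrix.of (A u)).det)
      ((Matrix.of (A t)).det * ((Matrix.of (A t))⁻¹ * A').trace) t := by
  have hfac : A' = Matrix.of (A t) * ((Matrix.of (A t))⁻¹ * A') := by
    rw [← Matrix.mul_assoc, Matrix.mul_nonsing_inv _ hinv, Matrix.one_mul]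
  have hA' : HasDerivAt A (Matrix.of (A t) * ((Matrix.of (A t))⁻¹ * A') : ι → ι → ℝ) t := by
    rw [← hfac]; exact hA
  exact hasDerivAt_det_of_eq_mul hA'

/-- **Logarithmic form**: `(log det A)' = tr (A⁻¹ A')` where `det A(t) > 0`. [folklore] -/
theorem hasDerivAt_log_det {A : ℝ → ι → ι → ℝ} {A' : Matrix ι ι ℝ} {t : ℝ}
    (hA : HasDerivAt A (A' : ι → ι → ℝ) t) (hpos : 0 < (Matrix.of (A t)).det) :
    HasDerivAt (fun u ↦ Real.log (Matrix.of (A u)).det) (((Matrix.of (A t))⁻¹ * A').trace) t := by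
  have h := (hasDerivAt_det_eq_det_mul_trace hA (isUnit_iff_ne_zero.2 hpos.ne')).log hpos.ne'
  convert h using 1
  field_simp

/-- **The area-element form**: `(√det A)' = ½ √det A(t) · tr (A⁻¹ A')` where `det A(t) > 0` — the
evolution of the Riemannian area element `√det g` of an evolving metric `g(t)` in a chart
(for mean curvature flow `∂ₜg = -2HA`, `tr(g⁻¹ ∂ₜg) = -2H²`, giving `∂ₜ√det g = -H² √det g`).
[folklore] -/
theorem hasDerivAt_sqrt_det {A : ℝ → ι → ι → ℝ} {A' : Matrix ι ι ℝ} {t : ℝ}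
    (hA : HasDerivAt A (A' : ι → ι → ℝ) t) (hpos : 0 < (Matrix.of (A t)).det) :
    HasDerivAt (fun u ↦ Real.sqrt (Matrix.of (A u)).det)
      (Real.sqrt (Matrix.of (A t)).det / 2 * ((Matrix.of (A t))⁻¹ * A').trace) t := by
  have h := (hasDerivAt_det_eq_det_mul_trace hA (isUnit_iff_ne_zero.2 hpos.ne')).sqrt hpos.ne'
  convert h using 1
  have hs : Real.sqrt (Matrix.of (A t)).det ≠ 0 := (Real.sqrt_pos.2 hpos).ne'
  have hsq : Real.sqrt (Matrix.of (A t)).det ^ 2 = (Matrix.of (A t)).det := Real.sq_sqrt hpos.le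
  field_simp
  rw [hsq]
  ring

end Literature.Analysis.Calculus

end
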